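import Literature.Geometry.Lorentzian.TeukolskyBlowupPocket
import Literature.Geometry.Lorentzian.TeukolskyBlowupTransport
import Literature.Geometry.Lorentzian.CarterFarSupBound
import Literature.Geometry.Lorentzian.KerrSurfaceGravity
import HarnessLib

/-!
# Ports of the polynomial sup bound for the horizon-normalised scalar radial Teukolsky solution:
# the two horizon pockets and the far zone in the chart-free port `‖R r‖ + (r − r₊)‖R′ r‖`
(namespace `Literature.Geometry.Lorentzian.Kerr`.)

Companion of `TeukolskyBlowupPocket.lean` (`|ξ| ≤ 1`), `CarterHorizonPocket.lean` (`|ξ| ≥ 1`),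
`TeukolskyBlowupTransport.lean` (Euler zone) and `CarterFarSupBound.lean` (far zone). Each zone
lemma is restated here with its conclusion in the common PORT `D(r) = ‖R r‖ + (r − r₊)‖R′ r‖`
(`R′ = deriv R`) and with its frequency-dependent constants bounded on a box `Λ ≤ Λ₁`,
`M|ω| ≤ Λ₁`, so that the Summits-side assembly (crux `KappaExplicitWaveDecay`, stub
`stub_horizonSupBoxPoly`) is pure plumbing:

* `kerr_box_geometry` — `0 < κ ≤ 1/(4M)`, `r₊ − r₋ = 2κ(r₊² + a²)`, `M² ≤ r₊² + a² ≤ 8M²`,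
  `M ≤ r₊ ≤ 2M` for `|a| < M`;
* `cone_frequency_box` — in the cone `|ω − mω₊| ≤ ε₀|m|` with `ε₀ ≤ 1/(16M)`, `M/2 ≤ |a|`,
  `m ≠ 0`, admissible `(ω, m, Λ)`, `Λ ≤ Λ₀`: `1 ≤ Λ ≤ Λ₁`, `M|ω| ≤ Λ₁`, `1/(16M) ≤ |ω|`,
  `|ω − mω₊| ≤ ε₀√Λ₁` (`Λ₁ = max Λ₀ 2`);
* `smallXi_pocket_port` — `|ξ| ≤ 1`: `√(r² + a²)‖R r‖ ≤ 5M√B₁` on `r₊ < r ≤ r₊ + d` and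
  `D(r₊ + d) ≤ 7√B₁`, `B₁ = exp((1 + C₁)²)/M²`, `C₁ = 4Λ₁ + 6Λ₁(2 + 6Λ₁) + 15/4`;
* `largeXi_pocket_port` — `|ξ| ≥ 1`: `√(r² + a²)‖R r‖ ≤ 49P` on `r₊ < r ≤ r₁ = r₊ + c₁|σ|(r₊² + a²)`
  and `D(r₁) ≤ P·(98/M + 28M|σ|/d)`, `P = ((ω² + 6Λ/M²)/(σ²/800))⁴`;
* `far_sup_of_port` — `√(r² + a²)‖R r‖ ≤ (√(R_F² + a²) + 23M(1 + √(R_F² + a²)/(R_F − r₊)))·D(R_F)`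
  for `r ≥ R_F ≥ max(7M, √(12Λ)/|ω|, 1/(Mω²))` when `1/(16M) ≤ |ω|`.

Everything is proved; no named fact is used.

## References
* R. Teixeira da Costa, CMP 378 (2020) 705–781 = arXiv:1910.02854, Def. 2.3. [Costa2019]
* M. Dafermos, I. Rodnianski, Y. Shlapentokh-Rothman, arXiv:1402.7034, §8.
  [DafermosRodnianskiShlapentokhrothman2014]
-/

noncomputable section

namespace Literature.Geometry.Lorentzian

namespace Kerr

open Filter Set Complex
open scoped _root_.Topology

/-! ### Box facts -/

/-- **Geometry of the sub-extremal box**: for `0 < M`, `|a| < M`: `0 < κ ≤ 1/(4M)`,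
`r₊ − r₋ = 2κ(r₊² + a²)`, `M² ≤ r₊² + a² ≤ 8M²`, `M ≤ r₊ ≤ 2M`. [folklore] -/
theorem kerr_box_geometry {M a : ℝ} (hM : 0 < M) (ha : |a| < M) :
    0 < surfaceGravity M a ∧ surfaceGravity M a ≤ 1 / (4 * M) ∧
    rPlus M a - rMinus M a = 2 * surfaceGravity M a * (rPlus M a ^ 2 + a ^ 2) ∧
    M ^ 2 ≤ rPlus M a ^ 2 + a ^ 2 ∧ rPlus M a ^ 2 + a ^ 2 ≤ 8 * M ^ 2 ∧
    M ≤ rPlus M a ∧ rPlus M a ≤ 2 * M := by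
  have hsub : IsSubextremal M a := ha
  have hMr : M ≤ rPlus M a := M_le_rPlus M a
  have hr2 : rPlus M a ≤ 2 * M := rPlus_le_two_mul_self hM.le a
  have hrp : 0 < rPlus M a := rPlus_pos hM a
  have hA : 0 < rPlus M a ^ 2 + a ^ 2 := by positivity
  have ha2 : a ^ 2 ≤ M ^ 2 := by nlinarith [abs_nonneg a, sq_abs a, ha.le]
  refine ⟨hsub.surfaceGravity_pos, surfaceGravity_le hM a, ?_, by nlinarith, by nlinarith, hMr, hr2⟩
  rw [surfaceGravity_eq_rPlus_sub_rMinus_div]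
  field_simp

/-- **Frequencies in the cone, on the box**: for `0 < M`, `M/2 ≤ |a|`, admissible `(ω, m, Λ)` with
`m ≠ 0`, `Λ ≤ Λ₀`, `0 < ε₀ ≤ 1/(16M)` and `|ω − mω₊| ≤ ε₀|m|`: with `Λ₁ = max Λ₀ 2`,
`1 ≤ Λ ≤ Λ₁`, `M|ω| ≤ Λ₁` (`2|amω| ≤ Λ`), `1/(16M) ≤ |ω|` (`Costa2019.abs_omega_lower_of_cone`), hence
`ω ≠ 0`, and `|ω − mω₊| ≤ ε₀√Λ₁` (`|m| ≤ √Λ`). [folklore] -/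
theorem cone_frequency_box {M Λ₀ ε₀ a ω Λ : ℝ} {m : ℤ} (hM : 0 < M) (ha₁ : M / 2 ≤ |a|)
    (hadm : IsAdmissibleTriple a ω m Λ) (hm : m ≠ 0) (hΛ₀ : Λ ≤ Λ₀) (hε0 : 0 < ε₀)
    (hε : ε₀ ≤ 1 / (16 * M)) (hcone : |ω - m * horizonAngularVelocity M a| ≤ ε₀ * |(m : ℝ)|) :
    1 ≤ Λ ∧ Λ ≤ max Λ₀ 2 ∧ M * |ω| ≤ max Λ₀ 2 ∧ 1 / (16 * M) ≤ |ω| ∧ ω ≠ 0 ∧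
      |ω - m * horizonAngularVelocity M a| ≤ ε₀ * Real.sqrt (max Λ₀ 2) := by
  have hm1 : (1 : ℝ) ≤ |(m : ℝ)| := by exact_mod_cast Int.one_le_abs hm
  have hΛm : |(m : ℝ)| * (|(m : ℝ)| + 1) ≤ Λ := hadm.1
  have hΛ1 : 1 ≤ Λ := by nlinarith
  have hΛ₁ : Λ ≤ max Λ₀ 2 := hΛ₀.trans (le_max_left _ _)
  have hω : M * |ω| ≤ max Λ₀ 2 := by
    have h2 : 2 * |a * m * ω| ≤ Λ := hadm.2
    rw [abs_mul, abs_mul] at h2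
    have h3 : M / 2 * (1 * |ω|) ≤ |a| * (|(m : ℝ)| * |ω|) :=
      mul_le_mul ha₁ (mul_le_mul_of_nonneg_right hm1 (abs_nonneg _)) (by positivity)
        (abs_nonneg _)
    nlinarith
  have hωlow : 1 / (16 * M) ≤ |ω| := by
    have h := Costa2019.abs_omega_lower_of_cone hM (half_pos hM) ha₁ hcone
    have h1 : M / 2 / (4 * M ^ 2) = 1 / (8 * M) := by field_simp; ring
    rw [h1] at h
    have h2 : 1 / (16 * M) ≤ 1 / (8 * M) - ε₀ := by
      have : 1 / (16 * M) + 1 / (16 * M) = 1 / (8 * M) := by field_simp; ring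
      linarith
    have h3 : 0 ≤ 1 / (8 * M) - ε₀ := le_trans (by positivity) h2
    calc 1 / (16 * M) ≤ (1 / (8 * M) - ε₀) * 1 := by linarith
      _ ≤ (1 / (8 * M) - ε₀) * |(m : ℝ)| := mul_le_mul_of_nonneg_left hm1 h3
      _ ≤ |ω| := h
  have hω0 : ω ≠ 0 := abs_pos.1 (lt_of_lt_of_le (by positivity) hωlow)
  refine ⟨hΛ1, hΛ₁, hω, hωlow, hω0, hcone.trans ?_⟩
  have hmΛ : |(m : ℝ)| ≤ Real.sqrt (max Λ₀ 2) := by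
    apply Real.abs_le_sqrt
    exact hadm.sq_le.trans hΛ₁
  exact mul_le_mul_of_nonneg_left hmΛ hε0.le

/-! ### The `|ξ| ≤ 1` pocket in the port -/

/-- **The `|ξ| ≤ 1` pocket, box form.** Let `0 < M`, `|a| < M`, `(ω, m, Λ)` admissible with
`Λ ≤ Λ₁`, `M|ω| ≤ Λ₁`, `|ξ| ≤ 1` (`ξ = (2Mr₊/d)(ω − mω₊)`), `R` a classical radial solution
(differentiable on `r > r₊`) normalised at `𝓗⁺`, with derivative witnesses of the blown-up normal
form. Then, with `C₁ = 4Λ₁ + 6Λ₁(2 + 6Λ₁) + 15/4` and `B₁ = exp((1 + C₁)²)/M²`: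
`√(r² + a²)‖R r‖ ≤ 5M√B₁` for `r = r₊ + dx`, `x ∈ (0, 1]`, and
`‖R(r₊ + d)‖ + d·1·‖R′(r₊ + d)‖ ≤ 7√B₁` (`blowup_pocket_normSq_le`, `port_le_blowup_amplitude`,
`‖ν‖ ≤ 3/2`). [cite: Costa2019, Definition 2.3] -/
theorem smallXi_pocket_port {M a ω Λ Λ₁ : ℝ} {m : ℤ} (hM : 0 < M) (ha : |a| < M)
    (hadm : IsAdmissibleTriple a ω m Λ) (hΛ₁ : Λ ≤ Λ₁) (hωM : M * |ω| ≤ Λ₁)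
    (hξ : |2 * M * rPlus M a / (rPlus M a - rMinus M a) *
        (ω - m * horizonAngularVelocity M a)| ≤ 1)
    {R : ℝ → ℂ} (hRd : ∀ r, rPlus M a < r → DifferentiableAt ℝ R r)
    (hn : IsNormalisedHorizonSolution M a 0 ω m R) {W' W'' : ℝ → ℂ}
    (hW : ∀ x : ℝ, 0 < x →
      HasDerivAt (fun y : ℝ ↦ ((Real.sqrt (y * (y + 1)) : ℝ) : ℂ) *
          R (rPlus M a + (rPlus M a - rMinus M a) * y)) (W' x) x ∧
        HasDerivAt W' (W'' x) x ∧
        W'' x =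
          ((((Λ - 2 * a * m * ω) * (x * (x + 1)) -
                  (radialK a ω m (rPlus M a + (rPlus M a - rMinus M a) * x) /
                      (rPlus M a - rMinus M a)) ^ 2 - 1 / 4) /
                (x * (x + 1)) ^ 2 : ℝ) : ℂ) *
            (((Real.sqrt (x * (x + 1)) : ℝ) : ℂ) *
              R (rPlus M a + (rPlus M a - rMinus M a) * x))) :
    (∀ x ∈ Ioc (0 : ℝ) 1,
        Real.sqrt ((rPlus M a + (rPlus M a - rMinus M a) * x) ^ 2 + a ^ 2) *
            ‖R (rPlus M a + (rPlus M a - rMinus M a) * x)‖ ≤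
          5 * M * Real.sqrt (Real.exp ((1 + (4 * Λ₁ + 6 * Λ₁ * (2 + 6 * Λ₁) + 15 / 4)) ^ 2) /
            M ^ 2)) ∧
      ‖R (rPlus M a + (rPlus M a - rMinus M a) * 1)‖ +
          (rPlus M a - rMinus M a) * 1 * ‖deriv R (rPlus M a + (rPlus M a - rMinus M a) * 1)‖ ≤
        7 * Real.sqrt (Real.exp ((1 + (4 * Λ₁ + 6 * Λ₁ * (2 + 6 * Λ₁) + 15 / 4)) ^ 2) /
          M ^ 2) := by
  obtain ⟨hκ, hκ4, hdκ, hAM, hA8, hMr, hr2⟩ := kerr_box_geometry hM ha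
  set d := rPlus M a - rMinus M a with hd_def
  set rp := rPlus M a with hrp_def
  set A := rp ^ 2 + a ^ 2 with hA_def
  set ν : ℂ := (1 / 2 : ℂ) + horizonExponent M a ω m with hν_def
  set Cg := 4 * Λ + 6 * M * |ω| * (2 + 6 * M * |ω|) + 15 / 4 with hCg
  set C₁ := 4 * Λ₁ + 6 * Λ₁ * (2 + 6 * Λ₁) + 15 / 4 with hC₁
  set B₁ := Real.exp ((1 + C₁) ^ 2) / M ^ 2 with hB₁
  have hd : 0 < d := sub_pos.2 (IsSubextremal.rMinus_lt_rPlus ha)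
  have hd2 : d ≤ 2 * M := by
    rw [hd_def, hrp_def, rPlus_sub_rMinus]
    have : Real.sqrt (M ^ 2 - a ^ 2) ≤ Real.sqrt (M ^ 2) :=
      Real.sqrt_le_sqrt (by nlinarith [sq_nonneg a])
    rw [Real.sqrt_sq hM.le] at this
    linarith
  have hrp0 : 0 < rp := rPlus_pos hM a
  have hA0 : 0 < A := by positivity
  have hΛ0 : 0 ≤ Λ := hadm.nonneg
  have hMω : 0 ≤ M * |ω| := by positivity
  -- `Cg ≤ C₁`, hence `B ≤ B₁`
  have hCg1 : Cg ≤ C₁ := by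
    simp only [hCg, hC₁]
    nlinarith [mul_le_mul hωM hωM hMω (hMω.trans hωM)]
  have hCg0 : 0 ≤ Cg := by positivity
  have hB : Real.exp ((1 + Cg) ^ 2) / A ≤ B₁ := by
    rw [hB₁]
    apply div_le_div₀ (Real.exp_pos _).le _ (by positivity) hAM
    exact Real.exp_le_exp.2 (by nlinarith)
  have hB₁0 : 0 ≤ B₁ := by positivity
  have hsB : 0 ≤ Real.sqrt B₁ := Real.sqrt_nonneg _
  -- the pocket bound at any `x ∈ (0, 1]`
  have hpk : ∀ x ∈ Ioc (0 : ℝ) 1,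
      ‖((Real.sqrt (x * (x + 1)) : ℝ) : ℂ) * R (rp + d * x)‖ ^ 2 ≤ x * B₁ ∧
      ‖(x : ℂ) * W' x - ν * (((Real.sqrt (x * (x + 1)) : ℝ) : ℂ) * R (rp + d * x))‖ ^ 2 ≤
        x ^ 2 * B₁ := by
    intro x hx
    have h := blowup_pocket_normSq_le hM ha hadm hξ hn hW hx
    exact ⟨h.1.trans (mul_le_mul_of_nonneg_left hB hx.1.le),
      h.2.trans (mul_le_mul_of_nonneg_left hB (by positivity))⟩
  refine ⟨fun x hx ↦ ?_, ?_⟩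
  · -- the region bound
    have hx0 := hx.1
    have h1 := (hpk x hx).1
    obtain ⟨hS0, hS2, hxS, -, -⟩ := sqrt_mul_add_one_facts hx0
    rw [norm_mul, Complex.norm_of_nonneg hS0.le, mul_pow, hS2] at h1
    have hx1 : 0 < x * (x + 1) := by positivity
    have hR2 : ‖R (rp + d * x)‖ ^ 2 ≤ B₁ := by
      have h2 : x * B₁ ≤ x * (x + 1) * B₁ := by
        nlinarith [mul_nonneg (mul_nonneg hx0.le hx0.le) hB₁0]
      exact le_of_mul_le_mul_left (h1.trans h2) hx1
    have hR : ‖R (rp + d * x)‖ ≤ Real.sqrt B₁ := by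
      have := Real.abs_le_sqrt hR2
      rwa [abs_of_nonneg (norm_nonneg _)] at this
    have hr4 : rp + d * x ≤ 4 * M := by
      have : d * x ≤ 2 * M * 1 := mul_le_mul hd2 hx.2 hx0.le (by positivity)
      linarith
    have hr0 : 0 < rp + d * x := by have := mul_pos hd hx0; linarith
    have ha2 : a ^ 2 ≤ M ^ 2 := by
      rw [← sq_abs a]; exact pow_le_pow_left₀ (abs_nonneg a) ha.le 2
    have hsq : Real.sqrt ((rp + d * x) ^ 2 + a ^ 2) ≤ 5 * M := by
      rw [Real.sqrt_le_left (by positivity)]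
      have h16 := pow_le_pow_left₀ hr0.le hr4 2
      linarith
    exact mul_le_mul hsq hR (norm_nonneg _) (by positivity)
  · -- the port at `x = 1`
    have h1 : (0 : ℝ) < 1 := one_pos
    obtain ⟨hW1, hP1⟩ := hpk 1 ⟨h1, le_rfl⟩
    replace hW1 := hW1.trans (le_of_eq (one_mul B₁))
    replace hP1 := hP1.trans (le_of_eq (by ring : (1 : ℝ) ^ 2 * B₁ = B₁))
    have hr₁ : rp < rp + d * 1 := by linarith
    have hW'1 := (hW 1 h1).1.unique (hasDerivAt_blowup h1 (hRd _ hr₁))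
    have hport := port_le_blowup_amplitude h1 hd.le (R (rp + d * 1)) (deriv R (rp + d * 1))
    rw [← hW'1, one_mul] at hport
    -- `‖W 1‖ ≤ √B₁`, `‖W′ 1‖ ≤ (5/2)√B₁`
    have hnW : ‖((Real.sqrt (1 * (1 + 1)) : ℝ) : ℂ) * R (rp + d * 1)‖ ≤ Real.sqrt B₁ := by
      have := Real.abs_le_sqrt hW1
      rwa [abs_of_nonneg (norm_nonneg _)] at this
    have hnP : ‖(1 : ℂ) * W' 1 - ν * (((Real.sqrt (1 * (1 + 1)) : ℝ) : ℂ) * R (rp + d * 1))‖ ≤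
        Real.sqrt B₁ := by
      have := Real.abs_le_sqrt hP1
      rwa [Complex.ofReal_one, abs_of_nonneg (norm_nonneg _)] at this
    have hν : ‖ν‖ ≤ 3 / 2 := by
      have := norm_blowup_nu_le M a ω m
      rw [← hrp_def, ← hd_def] at this
      linarith
    have hnW' : ‖W' 1‖ ≤ 5 / 2 * Real.sqrt B₁ := by
      have e : W' 1 = ((1 : ℂ) * W' 1 - ν * (((Real.sqrt (1 * (1 + 1)) : ℝ) : ℂ) * R (rp + d * 1))) +
          ν * (((Real.sqrt (1 * (1 + 1)) : ℝ) : ℂ) * R (rp + d * 1)) := by ring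
      calc ‖W' 1‖ = ‖((1 : ℂ) * W' 1 - ν * (((Real.sqrt (1 * (1 + 1)) : ℝ) : ℂ) * R (rp + d * 1))) +
            ν * (((Real.sqrt (1 * (1 + 1)) : ℝ) : ℂ) * R (rp + d * 1))‖ := congrArg _ e
        _ ≤ ‖(1 : ℂ) * W' 1 - ν * (((Real.sqrt (1 * (1 + 1)) : ℝ) : ℂ) * R (rp + d * 1))‖ +
            ‖ν * (((Real.sqrt (1 * (1 + 1)) : ℝ) : ℂ) * R (rp + d * 1))‖ := norm_add_le _ _
        _ ≤ Real.sqrt B₁ + 3 / 2 * Real.sqrt B₁ := by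
            rw [norm_mul]
            exact add_le_add hnP (mul_le_mul hν hnW (norm_nonneg _) (by norm_num))
        _ = 5 / 2 * Real.sqrt B₁ := by ring
    calc _ ≤ _ := hport
      _ ≤ 2 * (Real.sqrt B₁ + 1 * (5 / 2 * Real.sqrt B₁)) := by gcongr
      _ = 7 * Real.sqrt B₁ := by ring

/-! ### The `|ξ| ≥ 1` pocket in the port -/
set_option maxHeartbeats 400000 in -- buildfix (bf3-g27): 160k/180k FAIL, 200k PASS at accept time; line-neutral budget line
/-- **The `|ξ| ≥ 1` pocket, port form.** Under the hypotheses of `horizonPocket_weightedNormSq_le`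
(`0 < c₁ ≤ 1`, `10M|ω|c₁ ≤ 1`, `16(2Λ + 3)c₁ ≤ 1`, `r₊ − r₋ ≤ |σ|(r₊² + a²)`, `Λ ≥ 1`) and
`c₁|σ|(r₊² + a²) ≤ M`, with `P = ((ω² + 6Λ/M²)/(σ²/800))⁴` and `r₁ = r₊ + c₁|σ|(r₊² + a²)`:
`√(r² + a²)‖R r‖ ≤ 49P` for `r₊ < r ≤ r₁`, and
`‖R r₁‖ + (r₁ − r₊)‖R′ r₁‖ ≤ P·(98/M + 28M|σ|/(r₊ − r₋))`
(`√2400 < 49`; `(r₁ − r₊)/Δ(r₁) = 1/(r₁ − r₋) ≤ 1/(r₊ − r₋)`, `r₁² + a² ≤ 16M²`, `16√3 < 28`).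
[folklore] -/
theorem largeXi_pocket_port {M a ω Λ c₁ : ℝ} {m : ℤ} (hM : 0 < M) (ha : |a| < M)
    (hadm : IsAdmissibleTriple a ω m Λ) (hΛ : 1 ≤ Λ) (hc₀ : 0 < c₁) (hc₁ : c₁ ≤ 1)
    (hcω : 10 * M * |ω| * c₁ ≤ 1) (hcΛ : 16 * (2 * Λ + 3) * c₁ ≤ 1)
    (hσ : rPlus M a - rMinus M a ≤ |ω - m * horizonAngularVelocity M a| * (rPlus M a ^ 2 + a ^ 2))
    (hrM : c₁ * |ω - m * horizonAngularVelocity M a| * (rPlus M a ^ 2 + a ^ 2) ≤ M)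
    {R : ℝ → ℂ} (hR : IsRadialTeukolskySolution M a 0 ω m (Λ - a ^ 2 * ω ^ 2) R)
    (hn : IsNormalisedHorizonSolution M a 0 ω m R) :
    (∀ r, rPlus M a < r →
        r - rPlus M a ≤ c₁ * |ω - m * horizonAngularVelocity M a| * (rPlus M a ^ 2 + a ^ 2) →
          Real.sqrt (r ^ 2 + a ^ 2) * ‖R r‖ ≤
            49 * ((ω ^ 2 + 6 * Λ / M ^ 2) / ((ω - m * horizonAngularVelocity M a) ^ 2 / 800)) ^ 4) ∧
      ‖R (rPlus M a + c₁ * |ω - m * horizonAngularVelocity M a| * (rPlus M a ^ 2 + a ^ 2))‖ +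
          (c₁ * |ω - m * horizonAngularVelocity M a| * (rPlus M a ^ 2 + a ^ 2)) *
            ‖deriv R (rPlus M a + c₁ * |ω - m * horizonAngularVelocity M a| *
              (rPlus M a ^ 2 + a ^ 2))‖ ≤
        ((ω ^ 2 + 6 * Λ / M ^ 2) / ((ω - m * horizonAngularVelocity M a) ^ 2 / 800)) ^ 4 *
          (98 / M + 28 * M * |ω - m * horizonAngularVelocity M a| / (rPlus M a - rMinus M a)) := by
  obtain ⟨hκ, hκ4, hdκ, hAM, hA8, hMr, hr2⟩ := kerr_box_geometry hM ha
  set d := rPlus M a - rMinus M a with hd_def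
  set rp := rPlus M a with hrp_def
  set Ap := rp ^ 2 + a ^ 2 with hAp_def
  set σ := ω - m * horizonAngularVelocity M a with hσ_def
  set ratio := (ω ^ 2 + 6 * Λ / M ^ 2) / (σ ^ 2 / 800) with hratio
  set ℓ := c₁ * |σ| * Ap with hℓ
  have hd : 0 < d := sub_pos.2 (IsSubextremal.rMinus_lt_rPlus ha)
  have hσ0 : 0 < |σ| := by
    by_contra h
    push Not at h
    have : |σ| = 0 := le_antisymm h (abs_nonneg σ)
    rw [this, zero_mul] at hσ
    linarith
  have hratio0 : 0 ≤ ratio := by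
    rw [hratio]
    have : 0 < σ ^ 2 / 800 := by rw [← sq_abs]; positivity
    have hΛ0 : 0 ≤ Λ := hadm.nonneg
    positivity
  have hAp0 : 0 < Ap := by have := rPlus_pos hM a; positivity
  have hℓ0 : 0 < ℓ := mul_pos (mul_pos hc₀ hσ0) hAp0
  have hdiff : ∀ r, rp < r → DifferentiableAt ℝ R r := by
    obtain ⟨R', R'', h⟩ := hR
    exact fun r hr ↦ (h r hr).1.differentiableAt
  -- the weighted bound at any point of the pocket
  have hpt : ∀ r, rp < r → r - rp ≤ ℓ →
      Real.sqrt (r ^ 2 + a ^ 2) * ‖R r‖ ≤ 49 * ratio ^ 4 ∧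
      delta M a r / (r ^ 2 + a ^ 2) *
          ‖deriv (fun s : ℝ ↦ ((Real.sqrt (s ^ 2 + a ^ 2) : ℝ) : ℂ) * R s) r‖ ≤
        Real.sqrt 3 * |σ| * ratio ^ 4 := by
    intro r hr hrℓ
    have h := horizonPocket_weightedNormSq_le hM ha hadm hΛ hc₀ hc₁ hcω hcΛ hσ hR hn hr hrℓ
      (hrℓ.trans hrM)
    constructor
    · have h1 : (Real.sqrt (r ^ 2 + a ^ 2) * ‖R r‖) ^ 2 ≤ (49 * ratio ^ 4) ^ 2 := by
        calc _ ≤ 2400 * ratio ^ 8 := h.1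
          _ ≤ (49 * ratio ^ 4) ^ 2 := by nlinarith [pow_nonneg hratio0 8]
      exact (pow_le_pow_iff_left₀ (by positivity) (by positivity) two_ne_zero).1 h1
    · have h1 : (delta M a r / (r ^ 2 + a ^ 2) *
          ‖deriv (fun s : ℝ ↦ ((Real.sqrt (s ^ 2 + a ^ 2) : ℝ) : ℂ) * R s) r‖) ^ 2 ≤
          (Real.sqrt 3 * |σ| * ratio ^ 4) ^ 2 := by
        calc _ ≤ 3 * σ ^ 2 * ratio ^ 8 := h.2
          _ = (Real.sqrt 3 * |σ| * ratio ^ 4) ^ 2 := by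
              rw [mul_pow, mul_pow, Real.sq_sqrt (by norm_num : (0 : ℝ) ≤ 3), sq_abs]; ring
      have hΔ : 0 ≤ delta M a r / (r ^ 2 + a ^ 2) :=
        div_nonneg (delta_nonneg ha.le hr.le) (by positivity)
      exact (pow_le_pow_iff_left₀ (by positivity) (by positivity) two_ne_zero).1 h1
  refine ⟨fun r hr hrℓ ↦ (hpt r hr hrℓ).1, ?_⟩
  -- the port at `r₁ = r₊ + ℓ`
  set r₁ := rp + ℓ with hr₁
  have hr₁p : rp < r₁ := by simp only [hr₁]; linarith
  have hr₁M : r₁ - rp ≤ M := by simp only [hr₁]; linarith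
  have hr₁0 : 0 < r₁ := (rPlus_pos hM a).trans hr₁p
  have hA₁ : 0 < r₁ ^ 2 + a ^ 2 := by positivity
  have hA₁M : M ^ 2 ≤ r₁ ^ 2 + a ^ 2 := by nlinarith [sq_nonneg a]
  have hsA₁ : M ≤ Real.sqrt (r₁ ^ 2 + a ^ 2) := by
    rw [← Real.sqrt_sq hM.le]; exact Real.sqrt_le_sqrt hA₁M
  have hsA₁4 : Real.sqrt (r₁ ^ 2 + a ^ 2) ≤ 4 * M := by
    rw [Real.sqrt_le_left (by positivity)]
    have h3 : r₁ ≤ 3 * M := by linarith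
    have ha2 : a ^ 2 ≤ M ^ 2 := by
      rw [← sq_abs a]; exact pow_le_pow_left₀ (abs_nonneg a) ha.le 2
    have h9 := pow_le_pow_left₀ hr₁0.le h3 2
    linarith
  obtain ⟨hR₁, hD₁⟩ := hpt r₁ hr₁p (by simp only [hr₁]; linarith)
  set P := ratio ^ 4 with hP
  have hP0 : 0 ≤ P := by positivity
  -- `‖R r₁‖ ≤ 49P/M`
  have hnR : ‖R r₁‖ ≤ 49 * P / M := by
    rw [le_div_iff₀ hM]
    calc ‖R r₁‖ * M ≤ ‖R r₁‖ * Real.sqrt (r₁ ^ 2 + a ^ 2) :=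
          mul_le_mul_of_nonneg_left hsA₁ (norm_nonneg _)
      _ = Real.sqrt (r₁ ^ 2 + a ^ 2) * ‖R r₁‖ := mul_comm _ _
      _ ≤ 49 * P := hR₁
  -- `(r₁ − r₊)‖R′ r₁‖ ≤ 8M|σ|P/d + 49P/M`
  have hΔ₁ : delta M a r₁ = ℓ * (r₁ - rMinus M a) := by
    rw [delta_eq_mul ha.le]; simp only [hr₁]; ring
  have hr₁m : d ≤ r₁ - rMinus M a := by simp only [hr₁, hd_def]; linarith
  have hΔ₁0 : 0 < delta M a r₁ := delta_pos ha.le hr₁p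
  set Dw := deriv (fun s : ℝ ↦ ((Real.sqrt (s ^ 2 + a ^ 2) : ℝ) : ℂ) * R s) r₁ with hDw_def
  have hDw : ‖Dw‖ ≤ Real.sqrt 3 * |σ| * P * ((r₁ ^ 2 + a ^ 2) / delta M a r₁) := by
    have hc : 0 < delta M a r₁ / (r₁ ^ 2 + a ^ 2) := div_pos hΔ₁0 hA₁
    have := (le_div_iff₀' hc).2 hD₁
    rwa [div_div_eq_mul_div, mul_div_assoc] at this
  have hRd₁ := norm_deriv_le_of_sqrtWeight hA₁ (hdiff r₁ hr₁p)
  -- `ℓ‖R′ r₁‖·√(r₁² + a²) ≤ √3|σ|P(r₁² + a²)/d + 49ℓP/M`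
  have hA₁d : (r₁ ^ 2 + a ^ 2) / (r₁ - rMinus M a) ≤ (r₁ ^ 2 + a ^ 2) / d :=
    div_le_div_of_nonneg_left hA₁.le hd hr₁m
  have h2 : ℓ * ‖Dw‖ ≤ Real.sqrt 3 * |σ| * P * ((r₁ ^ 2 + a ^ 2) / d) := by
    calc ℓ * ‖Dw‖ ≤ ℓ * (Real.sqrt 3 * |σ| * P * ((r₁ ^ 2 + a ^ 2) / delta M a r₁)) :=
          mul_le_mul_of_nonneg_left hDw hℓ0.le
      _ = Real.sqrt 3 * |σ| * P * ((r₁ ^ 2 + a ^ 2) / (r₁ - rMinus M a)) := by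
          rw [hΔ₁, show ℓ * (Real.sqrt 3 * |σ| * P * ((r₁ ^ 2 + a ^ 2) / (ℓ * (r₁ - rMinus M a)))) =
            Real.sqrt 3 * |σ| * P * (ℓ * (r₁ ^ 2 + a ^ 2) / (ℓ * (r₁ - rMinus M a))) by ring,
            mul_div_mul_left _ _ hℓ0.ne']
      _ ≤ Real.sqrt 3 * |σ| * P * ((r₁ ^ 2 + a ^ 2) / d) := by gcongr
  have hℓM : ℓ ≤ M := hrM
  have h3 : ℓ * ‖R r₁‖ ≤ M * (49 * P / M) := mul_le_mul hℓM hnR (norm_nonneg _) hM.le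
  have hkey : ℓ * ‖deriv R r₁‖ * M ≤ Real.sqrt 3 * |σ| * P * (16 * M ^ 2 / d) + 49 * P := by
    have h1 : ℓ * ‖deriv R r₁‖ * M ≤ ℓ * (‖Dw‖ + ‖R r₁‖) := by
      have hh : ‖deriv R r₁‖ * M ≤ ‖deriv R r₁‖ * Real.sqrt (r₁ ^ 2 + a ^ 2) :=
        mul_le_mul_of_nonneg_left hsA₁ (norm_nonneg _)
      have := mul_le_mul_of_nonneg_left (hh.trans hRd₁) hℓ0.le
      linarith
    have hA16 : r₁ ^ 2 + a ^ 2 ≤ 16 * M ^ 2 := by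
      have := hsA₁4
      rw [Real.sqrt_le_left (by positivity)] at this
      linarith
    have h4 : Real.sqrt 3 * |σ| * P * ((r₁ ^ 2 + a ^ 2) / d) ≤
        Real.sqrt 3 * |σ| * P * (16 * M ^ 2 / d) :=
      mul_le_mul_of_nonneg_left (div_le_div_of_nonneg_right hA16 hd.le) (by positivity)
    have h5 : M * (49 * P / M) = 49 * P := by field_simp
    linarith [h1, h2, h3, h4, h5]
  have hs3 : Real.sqrt 3 ≤ 7 / 4 := by
    rw [Real.sqrt_le_left (by norm_num)]; norm_num
  have hℓR : ℓ * ‖deriv R r₁‖ ≤ 28 * M * |σ| * P / d + 49 * P / M := by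
    have hrhs : Real.sqrt 3 * |σ| * P * (16 * M ^ 2 / d) + 49 * P ≤
        (28 * M * |σ| * P / d + 49 * P / M) * M := by
      have hq0 : 0 ≤ M ^ 2 * |σ| * P / d := by positivity
      have e1 : Real.sqrt 3 * |σ| * P * (16 * M ^ 2 / d) = 16 * Real.sqrt 3 * (M ^ 2 * |σ| * P / d) := by
        ring
      have e2 : 49 * P / M * M = 49 * P := div_mul_cancel₀ _ hM.ne'
      have e3 : 28 * M * |σ| * P / d * M = 28 * (M ^ 2 * |σ| * P / d) := by ring
      have h16 : 16 * Real.sqrt 3 * (M ^ 2 * |σ| * P / d) ≤ 28 * (M ^ 2 * |σ| * P / d) :=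
        mul_le_mul_of_nonneg_right (by linarith [hs3]) hq0
      calc _ = 16 * Real.sqrt 3 * (M ^ 2 * |σ| * P / d) + 49 * P := by rw [e1]
        _ ≤ 28 * (M ^ 2 * |σ| * P / d) + 49 * P := by linarith
        _ = _ := by rw [add_mul, e2, e3]
    exact le_of_mul_le_mul_right (hkey.trans hrhs) hM
  have hσd : 0 ≤ |σ| / d := by positivity
  calc ‖R r₁‖ + ℓ * ‖deriv R r₁‖ ≤ 49 * P / M + (28 * M * |σ| * P / d + 49 * P / M) :=
        add_le_add hnR hℓR
    _ = P * (98 / M + 28 * M * |σ| / d) := by ring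

/-! ### The far zone in the port -/

/-- **Far-zone sup bound in the port.** Let `0 < M`, `|a| < M`, `ω ≠ 0` with `1/(16M) ≤ |ω|`,
`(ω, m, Λ)` admissible, `R` a classical radial solution, and
`max(7M, √(12Λ)/|ω|, 1/(Mω²)) ≤ R_F ≤ r`. Then
`√(r² + a²)‖R r‖ ≤ (√(R_F² + a²) + 23M(1 + √(R_F² + a²)/(R_F − r₊)))·(‖R R_F‖ + (R_F − r₊)‖R′ R_F‖)`
(`far_weightedNormSq_le` with `Δ ≤ r² + a²`, `‖(√(·² + a²)R)′‖ ≤ ‖R‖ + √(r² + a²)‖R′‖`,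
`2/ω² ≤ 512M²`, `√512 < 23`). [cite: DafermosRodnianskiShlapentokhrothman2014, Prop. 8.4.1 (proof)] -/
theorem far_sup_of_port {M a ω Λ RF : ℝ} {m : ℤ} (hM : 0 < M) (ha : |a| < M) (hω : ω ≠ 0)
    (hω16 : 1 / (16 * M) ≤ |ω|) (hadm : IsAdmissibleTriple a ω m Λ) {R : ℝ → ℂ}
    (hR : IsRadialTeukolskySolution M a 0 ω m (Λ - a ^ 2 * ω ^ 2) R)
    (hRF : max (7 * M) (max (Real.sqrt (12 * Λ) / |ω|) (1 / (M * ω ^ 2))) ≤ RF) {r : ℝ}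
    (hr : RF ≤ r) :
    Real.sqrt (r ^ 2 + a ^ 2) * ‖R r‖ ≤
      (Real.sqrt (RF ^ 2 + a ^ 2) + 23 * M * (1 + Real.sqrt (RF ^ 2 + a ^ 2) / (RF - rPlus M a))) *
        (‖R RF‖ + (RF - rPlus M a) * ‖deriv R RF‖) := by
  have hfar := far_weightedNormSq_le hM ha hω hadm hR hRF hr
  have hrp : rPlus M a < RF := rPlus_lt_of_farRadius_le hM hRF
  have hRF0 : 0 < RF := (rPlus_pos hM a).trans hrp
  have hAF : 0 < RF ^ 2 + a ^ 2 := by positivity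
  set sF := Real.sqrt (RF ^ 2 + a ^ 2) with hsF
  set D := ‖R RF‖ + (RF - rPlus M a) * ‖deriv R RF‖ with hD
  have hsF0 : 0 < sF := Real.sqrt_pos.2 hAF
  have hgap : 0 < RF - rPlus M a := sub_pos.2 hrp
  have hD0 : 0 ≤ D := by positivity
  have hdiff : DifferentiableAt ℝ R RF := by
    obtain ⟨R', R'', h⟩ := hR
    exact (h RF hrp).1.differentiableAt
  -- the two data at `R_F`
  have h1 : sF * ‖R RF‖ ≤ sF * D := by
    apply mul_le_mul_of_nonneg_left _ hsF0.le
    rw [hD]; nlinarith [norm_nonneg (deriv R RF), norm_nonneg (R RF)]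
  have hΔ : delta M a RF / (RF ^ 2 + a ^ 2) ≤ 1 := by
    rw [div_le_one hAF]; unfold delta; nlinarith
  have hΔ0 : 0 ≤ delta M a RF / (RF ^ 2 + a ^ 2) := div_nonneg (delta_nonneg ha.le hrp.le) hAF.le
  have hDw : ‖deriv (fun s : ℝ ↦ ((Real.sqrt (s ^ 2 + a ^ 2) : ℝ) : ℂ) * R s) RF‖ ≤
      (1 + sF / (RF - rPlus M a)) * D := by
    have h := norm_deriv_sqrtWeight_mul_le hAF hdiff
    have h2 : sF * ‖deriv R RF‖ = sF / (RF - rPlus M a) * ((RF - rPlus M a) * ‖deriv R RF‖) := by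
      field_simp
    have h3 : sF / (RF - rPlus M a) * ((RF - rPlus M a) * ‖deriv R RF‖) ≤ sF / (RF - rPlus M a) * D := by
      apply mul_le_mul_of_nonneg_left _ (by positivity)
      rw [hD]; linarith [norm_nonneg (R RF)]
    have h4 : ‖R RF‖ ≤ D := by rw [hD]; nlinarith [norm_nonneg (deriv R RF)]
    calc _ ≤ ‖R RF‖ + sF * ‖deriv R RF‖ := h
      _ ≤ D + sF / (RF - rPlus M a) * D := by rw [h2]; exact add_le_add h4 h3
      _ = (1 + sF / (RF - rPlus M a)) * D := by ring
  have h2 : delta M a RF / (RF ^ 2 + a ^ 2) *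
      ‖deriv (fun s : ℝ ↦ ((Real.sqrt (s ^ 2 + a ^ 2) : ℝ) : ℂ) * R s) RF‖ ≤
      (1 + sF / (RF - rPlus M a)) * D := by
    calc _ ≤ 1 * ‖deriv (fun s : ℝ ↦ ((Real.sqrt (s ^ 2 + a ^ 2) : ℝ) : ℂ) * R s) RF‖ :=
          mul_le_mul_of_nonneg_right hΔ (norm_nonneg _)
      _ ≤ _ := by rw [one_mul]; exact hDw
  -- `2/ω² ≤ 512 M²`
  have hω2 : 2 / ω ^ 2 ≤ 512 * M ^ 2 := by
    have hω0 : 0 < |ω| := lt_of_lt_of_le (by positivity) hω16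
    rw [div_le_iff₀ (by positivity), ← sq_abs ω]
    have h16 : 1 ≤ 16 * M * |ω| := by
      rw [div_le_iff₀ (by positivity)] at hω16; linarith
    nlinarith [h16, mul_pos hM hω0]
  -- assemble the squares
  set E := (1 + sF / (RF - rPlus M a)) * D with hE
  have hE0 : 0 ≤ E := by positivity
  have hB2 : (delta M a RF / (RF ^ 2 + a ^ 2) *
      ‖deriv (fun s : ℝ ↦ ((Real.sqrt (s ^ 2 + a ^ 2) : ℝ) : ℂ) * R s) RF‖) ^ 2 ≤ E ^ 2 :=
    pow_le_pow_left₀ (mul_nonneg hΔ0 (norm_nonneg _)) h2 2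
  have hA2 : (sF * ‖R RF‖) ^ 2 ≤ (sF * D) ^ 2 := pow_le_pow_left₀ (by positivity) h1 2
  have hstep1 : (Real.sqrt (r ^ 2 + a ^ 2) * ‖R r‖) ^ 2 ≤ (sF * D) ^ 2 + 512 * M ^ 2 * E ^ 2 := by
    have h3 : 2 * (delta M a RF / (RF ^ 2 + a ^ 2) *
        ‖deriv (fun s : ℝ ↦ ((Real.sqrt (s ^ 2 + a ^ 2) : ℝ) : ℂ) * R s) RF‖) ^ 2 / ω ^ 2 ≤
        512 * M ^ 2 * E ^ 2 := by
      rw [mul_div_right_comm]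
      exact mul_le_mul hω2 hB2 (sq_nonneg _) (by positivity)
    linarith [hfar, hA2, h3]
  set t := 1 + sF / (RF - rPlus M a) with ht
  have ht0 : 0 ≤ t := by positivity
  have hstep2 : (sF * D) ^ 2 + 512 * M ^ 2 * E ^ 2 ≤ ((sF + 23 * M * t) * D) ^ 2 := by
    rw [hE]
    have h0 : 0 ≤ sF * D * (M * (t * D)) := by positivity
    have h0' : 0 ≤ M ^ 2 * (t * D) ^ 2 := by positivity
    have e : ((sF + 23 * M * t) * D) ^ 2 - ((sF * D) ^ 2 + 512 * M ^ 2 * (t * D) ^ 2) =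
        46 * (sF * D * (M * (t * D))) + 17 * (M ^ 2 * (t * D) ^ 2) := by ring
    linarith
  have hsq := hstep1.trans hstep2
  have hrhs0 : 0 ≤ (sF + 23 * M * t) * D := by positivity
  exact (pow_le_pow_iff_left₀ (by positivity) hrhs0 two_ne_zero).1 hsq


end Kerr

end Literature.Geometry.Lorentzian

end
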